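import Mathlib
import Summits.QuantumFields.YangMills.Theorems.CurvatureSandwichBound.Negative.Unbundled
import Summits.QuantumFields.YangMills.Theorems.IsotropyFromPowerCountingCurvatureSandwichBoundChainEngine
import HarnessLib

/-!
# `CurvatureSandwichBound` (Σ), line `Sketch`: one period of the TILTED chain read in the `e₀` frame

Support file for crux stmt-QuantumFields-18372 (`IsotropyFromPowerCounting.CurvatureSandwichBound`), registered skeleton
`Cruxes/CurvatureSandwichBound/Lines/Sketch.lean`: stub `stub_tiltedStep` (model-blind geometry + two general windows).

`R` is the quarter-turn frame (`IsQuarterTurnFrame R`), `f₁ = g ⊗ hh` a 45°-frame insertion windowed in `[u, 2u]` in its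
own time and narrow (`|x₁'| ≤ w`, `4w ≤ min(u,v)`), `s = 2u + v`, `c = √2/2`.  The tilted period
`Q⟨m, Y⟩ = ⟨2+m, T_{s·Re₀}(R·f₁† ⊗ (R·f₁ ⊗ T_{s·Re₀} Y))⟩` is rewritten (`tiltedPeriod_factor`, with
`2s·Re₀ = θ₁e₀ + θ₂e₀ − √2 s e₁`, `θ₁ = θ₂ = cs`) as `J₁ ⊗ T_{θ₁e₀} (J₂ ⊗ T_{θ₂e₀} (T_{−√2 s e₁} Y))` where, in TRUE
coordinates (`quarterTurn_symm_apply` & co.), `J₁ = conj g(s − c(x₀−x₁), c(x₀+x₁)) · conj hh(x₂,x₃)` is windowed in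
`[c(v−w), c(u+v+w)]` and `J₂ = g(c(x₀−x₁) − s/2, c(x₀+x₁) + s/2) · hh(x₂,x₃)` in `[c(u−w), c(2u+w)]`, both with the `L¹`
data of `g`, `hh` (`integrable_comp_planeIsometry`: affine isometries of `ℝ² ≅ ℂ` preserve Lebesgue measure; Mathlib's
`Complex.volume_preserving_equiv_real_prod`, `rotation`, `LinearIsometryEquiv.measurePreserving`).  Hence `Q⟨m,Y⟩` is
`e₀`-time-ordered for time-ordered `Y` (`isTimeOrdered_windowHead_appendTensor` twice), and two applications of the
general-window hypothesis (`a = c(v−w)`, `γ = c(u−w)`, then swapped; the `e₁`-translate is unitary, `translate_fieldVec`)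
with `(c(v−w))^{-μ} ≤ (v/2)^{-μ} ≤ 16 v^{-μ}` give `‖Ψ_{Q⟨m,Y⟩}‖ ≤ (C'·Mg·(Mh+Mh')·16·(u^{-μ}+v^{-μ}))² ‖Ψ_Y‖`.
References: Osterwalder–Schrader, CMP 31 (1973) §4.1; Glimm–Jaffe, Quantum Physics (1987) §6.1, §10.5.
-/

noncomputable section

namespace Summit.QuantumFields.YangMills.Theorems.CurvatureSandwichBound.Sketch

open scoped BigOperators SchwartzMap InnerProductSpace ComplexConjugate
open MeasureTheory Filter Topology
open Literature.MathematicalPhysics.QuantumLattice Literature.MathematicalPhysics.AQFT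
  Literature.MathematicalPhysics.QuantumFieldTheory Literature.Probability.LatticeModels
open Summit.QuantumFields.YangMills.Theorems.NPointIsotropy.Negative (E4)
open Summit.QuantumFields.YangMills.Theorems.CurvatureSandwichBound.Negative (SandwichBound IsQuarterTurnFrame)

/-- `(√2/2)² = 1/2`. -/
theorem sqrt_two_half_mul_self : Real.sqrt 2 / 2 * (Real.sqrt 2 / 2) = 1 / 2 := by
  rw [div_mul_div_comm, Real.mul_self_sqrt (by norm_num : (0:ℝ) ≤ 2)]; norm_num

/-- `2/3 ≤ √2/2 < 1`. -/
theorem sqrt_two_half_bounds : 2 / 3 ≤ Real.sqrt 2 / 2 ∧ Real.sqrt 2 / 2 < 1 := by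
  have h2 := Real.sq_sqrt (show (0:ℝ) ≤ 2 by norm_num)
  have h0 := Real.sqrt_nonneg 2
  constructor <;> nlinarith

/-- For `0 ≤ μ ≤ 4` and `x ≥ t/2 > 0`: `x^{-μ} ≤ (t/2)^{-μ} = 2^μ t^{-μ} ≤ 16 t^{-μ}`. -/
theorem rpow_neg_le_sixteen_mul {x t μ : ℝ} (hμ0 : 0 ≤ μ) (hμ4 : μ ≤ 4) (ht : 0 < t) (hxt : t / 2 ≤ x) :
    x ^ (-μ) ≤ 16 * t ^ (-μ) := by
  have h1 : x ^ (-μ) ≤ (t / 2) ^ (-μ) := Real.rpow_le_rpow_of_nonpos (by positivity) hxt (by linarith)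
  have h2 : (t / 2) ^ (-μ) = 2 ^ μ * t ^ (-μ) := by
    rw [Real.div_rpow ht.le (by norm_num), Real.rpow_neg (by norm_num : (0:ℝ) ≤ 2), div_inv_eq_mul, mul_comm]
  have h3 : (2:ℝ) ^ μ ≤ 2 ^ (4:ℝ) := Real.rpow_le_rpow_of_exponent_le (by norm_num) hμ4
  have h4 : (2:ℝ) ^ (4:ℝ) = 16 := by rw [show (4:ℝ) = ((4:ℕ):ℝ) by norm_cast, Real.rpow_natCast]; norm_num
  calc x ^ (-μ) ≤ 2 ^ μ * t ^ (-μ) := h1.trans h2.le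
    _ ≤ 16 * t ^ (-μ) := mul_le_mul_of_nonneg_right (h3.trans h4.le) (Real.rpow_nonneg ht.le _)

/-- Coordinates of the inverse quarter turn: `(R⁻¹z)₀ = (z₀−z₁)/√2`, `(R⁻¹z)₁ = (z₀+z₁)/√2`, `(R⁻¹z)₂,₃ = z₂,₃`. -/
theorem quarterTurn_symm_apply {R : E4 ≃ₗᵢ[ℝ] E4} (hR : IsQuarterTurnFrame R) {c : ℝ} (hc : c = Real.sqrt 2 / 2)
    (z : E4) : R.symm z 0 = c * (z 0 - z 1) ∧ R.symm z 1 = c * (z 0 + z 1) ∧ R.symm z 2 = z 2 ∧ R.symm z 3 = z 3 := by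
  subst hc
  obtain ⟨h0, h1, h2, h3⟩ := hR (R.symm z)
  rw [R.apply_symm_apply] at h0 h1 h2 h3
  rw [Real.cos_pi_div_four, Real.sin_pi_div_four] at h0 h1
  have hc : Real.sqrt 2 / 2 * (Real.sqrt 2 / 2) = 1 / 2 := sqrt_two_half_mul_self
  refine ⟨?_, ?_, h2.symm, h3.symm⟩
  · linear_combination (-(Real.sqrt 2 / 2)) * h0 + (Real.sqrt 2 / 2) * h1 - 2 * R.symm z 0 * hc
  · linear_combination (-(Real.sqrt 2 / 2)) * h0 - (Real.sqrt 2 / 2) * h1 - 2 * R.symm z 1 * hc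

/-- The reflected inverse quarter turn `θ ∘ R⁻¹` in coordinates. -/
theorem quarterTurn_theta_symm_apply {R : E4 ≃ₗᵢ[ℝ] E4} (hR : IsQuarterTurnFrame R) {c : ℝ} (hc : c = Real.sqrt 2 / 2)
    (z : E4) : timeReflection 4 (R.symm z) 0 = -(c * (z 0 - z 1)) ∧ timeReflection 4 (R.symm z) 1 = c * (z 0 + z 1) ∧
      timeReflection 4 (R.symm z) 2 = z 2 ∧ timeReflection 4 (R.symm z) 3 = z 3 := by
  obtain ⟨h0, h1, h2, h3⟩ := quarterTurn_symm_apply hR hc z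
  simp [timeReflection_apply, h0, h1, h2, h3]

/-- Coordinates of the tilted time shift `s·Re₀ = (s/√2, −s/√2, 0, 0)`. -/
theorem quarterTurn_smul_single_apply {R : E4 ≃ₗᵢ[ℝ] E4} (hR : IsQuarterTurnFrame R) {c : ℝ} (hc : c = Real.sqrt 2 / 2)
    (s : ℝ) : (s • R (EuclideanSpace.single 0 1) : E4) 0 = s * c ∧ (s • R (EuclideanSpace.single 0 1) : E4) 1 = -(s * c) ∧
      (s • R (EuclideanSpace.single 0 1) : E4) 2 = 0 ∧ (s • R (EuclideanSpace.single 0 1) : E4) 3 = 0 := by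
  subst hc
  rw [hR.apply_single_zero, Real.cos_pi_div_four, Real.sin_pi_div_four]
  simp

/-- A product-form insertion `f = g(x₀,x₁)·hh(x₂,x₃)` with `g` vanishing off the time window `[lo, hi]` has
`tsupport f ⊆ {lo ≤ x⁰ ≤ hi}`. -/
theorem tsupport_subset_window_Icc {lo hi : ℝ} {f : 𝓢((Fin 1 → E4), ℂ)} {g hh : ℝ × ℝ → ℂ}
    (hf : ∀ x : Fin 1 → E4, f x = g (x 0 0, x 0 1) * hh (x 0 2, x 0 3)) (hg : ∀ p : ℝ × ℝ, g p ≠ 0 → lo ≤ p.1 ∧ p.1 ≤ hi) :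
    tsupport (f : (Fin 1 → E4) → ℂ) ⊆ {x | lo ≤ x 0 0 ∧ x 0 0 ≤ hi} := by
  refine closure_minimal (fun x hx => ?_) ?_
  · rw [Function.mem_support, hf x] at hx
    exact hg _ (left_ne_zero_of_mul hx)
  · have hcont : Continuous fun x : Fin 1 → E4 => x 0 0 := (EuclideanSpace.proj (0 : Fin 4)).continuous.comp (continuous_apply 0)
    exact (isClosed_le continuous_const hcont).inter (isClosed_le hcont continuous_const)

/-- **Head–tail time-ordering.**  A one-point head supported in times `[lo, hi]`, `0 < lo`, followed by the translate
by `θ e₀`, `θ > hi`, of a time-ordered tail, is time-ordered. -/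
theorem isTimeOrdered_windowHead_appendTensor {lo hi θ : ℝ} {f : 𝓢((Fin 1 → E4), ℂ)}
    (hf : tsupport (f : (Fin 1 → E4) → ℂ) ⊆ {x | lo ≤ x 0 0 ∧ x 0 0 ≤ hi}) (hlo : 0 < lo) (hhi : hi < θ)
    {n : ℕ} {W : 𝓢((Fin n → E4), ℂ)} (hW : IsTimeOrdered W) :
    IsTimeOrdered (f.appendTensor (translateMulti (θ • EuclideanSpace.single 0 1) W)) := by
  intro x hx
  obtain ⟨hxA, hxB⟩ := OSReconstructionNoE1.tsupport_appendTensor_subset _ _ hx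
  have hhead : lo ≤ x (Fin.castAdd n 0) 0 ∧ x (Fin.castAdd n 0) 0 ≤ hi := hf hxA
  have hT : (∀ j, 0 < (x (Fin.natAdd 1 j) - θ • EuclideanSpace.single 0 1 : E4) 0) ∧
      StrictMono fun j => (x (Fin.natAdd 1 j) - θ • EuclideanSpace.single 0 1 : E4) 0 :=
    hW (OSReconstructionNoE1.tsupport_translateMulti_subset _ _ hxB)
  simp only [PiLp.sub_apply, smul_single_apply_zero] at hT
  refine timeOrdered_of_head_tail x (by linarith [hhead.1]) (fun j => ?_) (fun i j hij => ?_)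
  · have := hT.1 j
    linarith [hhead.2]
  · have := hT.2 hij
    simp only at this
    linarith

/-- Field vectors of equal test functions are equal. -/
theorem fieldVec_congr_testFunction {S : SchwingerFamily E4} (h : OSReconstructionNoE1 S.toLabelled) {n : ℕ}
    {F G : 𝓢((Fin n → E4), ℂ)} (hFG : F = G) (hF : IsTimeOrdered F) (hG : IsTimeOrdered G) :
    h.fieldVec n (fun _ => ()) F hF = h.fieldVec n (fun _ => ()) G hG := by
  subst hFG
  rfl

/-- **Translations distribute over `⊗` and compose additively**: if `a + a = θ₁e₀ + θ₂e₀ + b` then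
`T_a (A ⊗ (B ⊗ T_a Y)) = T_a A ⊗ T_{θ₁e₀} (T_{a−θ₁e₀} B ⊗ T_{θ₂e₀} (T_b Y))` (pointwise bookkeeping). -/
theorem tiltedPeriod_factor {m : ℕ} (A B : 𝓢((Fin 1 → E4), ℂ)) (Y : 𝓢((Fin m → E4), ℂ)) (a b : E4) (θ₁ θ₂ : ℝ)
    (hab : a + a = θ₁ • EuclideanSpace.single 0 1 + θ₂ • EuclideanSpace.single 0 1 + b) :
    translateMulti a (A.appendTensor (B.appendTensor (translateMulti a Y))) =
      (translateMulti a A).appendTensor (translateMulti (θ₁ • EuclideanSpace.single 0 1)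
        ((translateMulti (a - θ₁ • EuclideanSpace.single 0 1) B).appendTensor
          (translateMulti (θ₂ • EuclideanSpace.single 0 1) (translateMulti b Y)))) := by
  ext x
  simp only [SchwartzMap.appendTensor_apply, translateMulti_apply, Function.comp_def]
  congr 2
  · congr 1
    funext i
    abel
  · congr 1
    funext i
    simp only [sub_sub]
    rw [hab]

/-- **Change of variables by an affine isometry of the plane.**  For a real linear isometry `L` of `ℂ ≅ ℝ²` and `d ∈ ℂ`,
the map `φ(p) = d + L p` (read back in `ℝ × ℝ`) preserves Lebesgue measure, so `g ∘ φ` is integrable with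
`∫ ‖g ∘ φ‖ = ∫ ‖g‖`. -/
theorem integrable_comp_planeIsometry (L : ℂ ≃ₗᵢ[ℝ] ℂ) (d : ℂ) (φ : ℝ × ℝ → ℝ × ℝ)
    (hφ : ∀ p : ℝ × ℝ, φ p = ((d + L ⟨p.1, p.2⟩).re, (d + L ⟨p.1, p.2⟩).im)) {g : ℝ × ℝ → ℂ} (hg : Integrable g) :
    Integrable (fun p => g (φ p)) ∧ ∫ p, ‖g (φ p)‖ = ∫ p, ‖g p‖ := by
  set Φ : ℝ × ℝ ≃ᵐ ℝ × ℝ := Complex.measurableEquivRealProd.symm.trans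
    (L.toMeasurableEquiv.trans ((MeasurableEquiv.addLeft d).trans Complex.measurableEquivRealProd)) with hΦdef
  have hΦ : MeasurePreserving Φ volume volume :=
    Complex.volume_preserving_equiv_real_prod.comp ((measurePreserving_add_left volume d).comp
      (L.measurePreserving.comp Complex.volume_preserving_equiv_real_prod.symm))
  have hΦapply : ∀ p : ℝ × ℝ, Φ p = φ p := fun p => by rw [hφ]; rfl
  have hfun : (g ∘ Φ) = fun p => g (φ p) := funext fun p => by simp only [Function.comp_apply, hΦapply]
  refine ⟨?_, ?_⟩
  · have := hΦ.integrable_comp_of_integrable hg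
    rwa [hfun] at this
  · rw [← hΦ.integral_comp' (g := fun q => ‖g q‖)]
    simp only [hΦapply]

/-- The eighth root of unity `e^{iπ/4} = (1 + i)/√2`. -/
theorem circleExp_pi_div_four {c : ℝ} (hc : c = Real.sqrt 2 / 2) : ((Circle.exp (Real.pi / 4) : Circle) : ℂ) = ⟨c, c⟩ := by
  subst hc
  apply Complex.ext
  · rw [Circle.coe_exp, Complex.exp_ofReal_mul_I_re, Real.cos_pi_div_four]
  · rw [Circle.coe_exp, Complex.exp_ofReal_mul_I_im, Real.sin_pi_div_four]

/-- The affine isometry `p ↦ (c(p₁−p₂) − s/2, c(p₁+p₂) + s/2)` (rotation by `π/4`, then a translation). -/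
theorem planeIsometry_rot {c : ℝ} (hc : c = Real.sqrt 2 / 2) (s : ℝ) (p : ℝ × ℝ) :
    (c * (p.1 - p.2) - s / 2, c * (p.1 + p.2) + s / 2) =
      (((⟨-(s / 2), s / 2⟩ : ℂ) + rotation (Circle.exp (Real.pi / 4)) ⟨p.1, p.2⟩).re,
        ((⟨-(s / 2), s / 2⟩ : ℂ) + rotation (Circle.exp (Real.pi / 4)) ⟨p.1, p.2⟩).im) := by
  rw [rotation_apply, circleExp_pi_div_four hc]
  apply Prod.ext
  · simp only [Complex.add_re, Complex.mul_re]; ring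
  · simp only [Complex.add_im, Complex.mul_im]; ring

/-- The affine isometry `p ↦ (s − c(p₁−p₂), c(p₁+p₂))` (rotation by `π/4`, conjugation, negation, then a translation). -/
theorem planeIsometry_rotConjNeg {c : ℝ} (hc : c = Real.sqrt 2 / 2) (s : ℝ) (p : ℝ × ℝ) :
    (s - c * (p.1 - p.2), c * (p.1 + p.2)) =
      (((⟨s, 0⟩ : ℂ) + ((rotation (Circle.exp (Real.pi / 4))).trans (Complex.conjLIE.trans (LinearIsometryEquiv.neg ℝ)))
          ⟨p.1, p.2⟩).re,
        ((⟨s, 0⟩ : ℂ) + ((rotation (Circle.exp (Real.pi / 4))).trans (Complex.conjLIE.trans (LinearIsometryEquiv.neg ℝ)))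
          ⟨p.1, p.2⟩).im) := by
  rw [LinearIsometryEquiv.trans_apply, LinearIsometryEquiv.trans_apply, rotation_apply, circleExp_pi_div_four hc,
    Complex.conjLIE_apply, LinearIsometryEquiv.coe_neg]
  apply Prod.ext
  · simp only [Complex.add_re, Complex.neg_re, Complex.conj_re, Complex.mul_re]; ring
  · simp only [Complex.add_im, Complex.neg_im, Complex.conj_im, Complex.mul_im]; ring

/-- Complex conjugation preserves integrability. -/
theorem integrable_conj_plane {f : ℝ × ℝ → ℂ} (hf : Integrable f) : Integrable (fun p => conj (f p)) :=
  hf.congr' (Complex.continuous_conj.comp_aestronglyMeasurable hf.aestronglyMeasurable)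
    (Eventually.of_forall fun _ => (Complex.norm_conj _).symm)

/-- **Stub (TS) — ONE PERIOD OF THE TILTED CHAIN IN THE `e₀` FRAME (model-blind geometry + two general windows).**
For the quarter-turn frame `R`, a narrow 45°-frame insertion `f₁ = g ⊗ hh` (window `[u, 2u]`, `|x₁'| ≤ w`,
`4w ≤ min(u,v)`) and the tilted period `Q⟨m, Y⟩ = ⟨2+m, T_{s·Re₀}(R·f₁† ⊗ (R·f₁ ⊗ T_{s·Re₀} Y))⟩` (`s = 2u+v`):
`Q⟨m,Y⟩` is `e₀`-time-ordered for every time-ordered `Y`, and two applications of the general-window bound (hypothesis,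
constant `C'`; read in true coordinates the two pieces are product-form insertions with the `L¹` data of `g`, `hh` and
`e₀`-windows `[(v−w)/√2, (u+v+w)/√2]`, `[(3u+v−w)/√2, (4u+v+w)/√2]`, the tail `T_{√2 s e₀} T_{-√2 s e₁} Y` starting after
`√2 s`; the `e₁`-translate is unitary) give `‖Ψ_{Q⟨m,Y⟩}‖ ≤ (C'·Mg·(Mh+Mh')·16·(u^{-μ}+v^{-μ}))² ‖Ψ_Y‖`. -/
theorem stub_tiltedStep :
    ∀ (S : SchwingerFamily E4) (h : OSReconstructionNoE1 S.toLabelled) (R : E4 ≃ₗᵢ[ℝ] E4),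
      IsQuarterTurnFrame R →
    ∀ (μ C' : ℝ), 0 ≤ μ → μ ≤ 4 → 0 ≤ C' →
      (∀ (a ℓ γ : ℝ), 0 < a → 0 ≤ ℓ → 0 < γ → a ≤ 1 → γ ≤ 1 →
        ∀ (f₁ : 𝓢((Fin 1 → E4), ℂ)) (g hh : ℝ × ℝ → ℂ) (Mg Mh Mh' : ℝ),
          (∀ x : Fin 1 → E4, f₁ x = g (x 0 0, x 0 1) * hh (x 0 2, x 0 3)) →
          (∀ p : ℝ × ℝ, g p ≠ 0 → a ≤ p.1 ∧ p.1 ≤ a + ℓ) →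
          Integrable g → (∫ p, ‖g p‖) ≤ Mg → Integrable hh → (∫ p, ‖hh p‖) ≤ Mh →
          (∀ p, ‖hh p‖ ≤ Mh') →
        ∀ (n : ℕ) (W : 𝓢((Fin n → E4), ℂ)) (hW : IsTimeOrdered W)
          (hFW : IsTimeOrdered
            (f₁.appendTensor (translateMulti ((a + ℓ + γ) • EuclideanSpace.single 0 1) W))),
          ‖h.fieldVec (1 + n) (fun _ => ())
              (f₁.appendTensor (translateMulti ((a + ℓ + γ) • EuclideanSpace.single 0 1) W)) hFW‖ ≤
            C' * Mg * (Mh + Mh') * (a ^ (-μ) + γ ^ (-μ)) * ‖h.fieldVec n (fun _ => ()) W hW‖) →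
    ∀ (u v w : ℝ), 0 < u → 0 < v → 0 < w → u ≤ 1 → v ≤ 1 → 4 * w ≤ u → 4 * w ≤ v →
    ∀ (f₁ : 𝓢((Fin 1 → E4), ℂ)) (g hh : ℝ × ℝ → ℂ) (Mg Mh Mh' : ℝ),
      (∀ x : Fin 1 → E4, f₁ x = g (x 0 0, x 0 1) * hh (x 0 2, x 0 3)) →
      (∀ p : ℝ × ℝ, g p ≠ 0 → u ≤ p.1 ∧ p.1 ≤ 2 * u ∧ |p.2| ≤ w) →
      Integrable g → (∫ p, ‖g p‖) ≤ Mg → Integrable hh → (∫ p, ‖hh p‖) ≤ Mh →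
      (∀ p, ‖hh p‖ ≤ Mh') →
    ∀ (Q : (Σ m : ℕ, 𝓢((Fin m → E4), ℂ)) → (Σ m : ℕ, 𝓢((Fin m → E4), ℂ))),
      (Q = fun Gσ => ⟨1 + (1 + Gσ.1),
        translateMulti ((2 * u + v) • R (EuclideanSpace.single 0 1))
          ((linActMulti R (osAdjoint f₁)).appendTensor
            ((linActMulti R f₁).appendTensor
              (translateMulti ((2 * u + v) • R (EuclideanSpace.single 0 1)) Gσ.2)))⟩) →
    ∀ (m : ℕ) (Y : 𝓢((Fin m → E4), ℂ)), IsTimeOrdered Y →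
      IsTimeOrdered (Q ⟨m, Y⟩).2 ∧
        ∀ (hY : IsTimeOrdered Y) (hQY : IsTimeOrdered (Q ⟨m, Y⟩).2),
          ‖h.fieldVec (Q ⟨m, Y⟩).1 (fun _ => ()) (Q ⟨m, Y⟩).2 hQY‖ ≤
            (C' * Mg * (Mh + Mh') * (16 * (u ^ (-μ) + v ^ (-μ)))) ^ 2 *
              ‖h.fieldVec m (fun _ => ()) Y hY‖ := by
  intro S h R hR μ C' hμ0 hμ4 hC' hGW u v w hu hv hw hu1 hv1 hwu hwv f₁ g hh Mg Mh Mh' hf₁ hg hgi hMg hhi hMh hMh' Q hQ m Y hY₀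
  subst hQ
  dsimp only
  -- constants
  obtain ⟨c, hc⟩ : ∃ c : ℝ, c = Real.sqrt 2 / 2 := ⟨_, rfl⟩
  have hc2 : c * c = 1 / 2 := by rw [hc]; exact sqrt_two_half_mul_self
  obtain ⟨hc23, hc1⟩ : 2 / 3 ≤ c ∧ c < 1 := by rw [hc]; exact sqrt_two_half_bounds
  have hc0 : 0 < c := by linarith
  have hwu' : w < u := by linarith
  have hwv' : w < v := by linarith
  have hMg0 : 0 ≤ Mg := (integral_nonneg fun _ => norm_nonneg _).trans hMg
  have hMh0 : 0 ≤ Mh := (integral_nonneg fun _ => norm_nonneg _).trans hMh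
  have hMh'0 : 0 ≤ Mh' := (norm_nonneg _).trans (hMh' 0)
  have hcu0 : 0 < c * (u - w) := mul_pos hc0 (by linarith)
  have hcv0 : 0 < c * (v - w) := mul_pos hc0 (by linarith)
  have hcu1 : c * (u - w) ≤ 1 := by nlinarith only [hc1, hc0, hu1, hw, hwu']
  have hcv1 : c * (v - w) ≤ 1 := by nlinarith only [hc1, hc0, hv1, hw, hwv']
  have hℓ0 : 0 ≤ c * (u + 2 * w) := by positivity
  -- coordinates of `θ ∘ R⁻¹`, `R⁻¹`, of the shift `a = s·Re₀` and of `e₀`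
  have hθ := quarterTurn_theta_symm_apply hR hc
  have hR' := quarterTurn_symm_apply hR hc
  have ha' := quarterTurn_smul_single_apply hR hc (2 * u + v)
  generalize ha : ((2 * u + v) • R (EuclideanSpace.single 0 1) : E4) = a at ha' ⊢
  obtain ⟨ha0, ha1, ha2, ha3⟩ := ha'
  have hs0 : (EuclideanSpace.single 0 (1:ℝ) : E4) 0 = 1 := by simp
  have hs1 : (EuclideanSpace.single 0 (1:ℝ) : E4) 1 = 0 := by simp
  have hs2 : (EuclideanSpace.single 0 (1:ℝ) : E4) 2 = 0 := by simp
  have hs3 : (EuclideanSpace.single 0 (1:ℝ) : E4) 3 = 0 := by simp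
  have hrev : Fin.rev (0 : Fin 1) = 0 := Subsingleton.elim _ _
  -- the tail shift `b = -√2 s e₁` and the vector identity `a + a = θ₁e₀ + θ₂e₀ + b`
  have hb0 : ((-(2 * (2 * u + v) * c)) • EuclideanSpace.single 1 1 : E4) 0 = 0 := by simp
  have hab : a + a = (c * (v - w) + c * (u + 2 * w) + c * (u - w)) • EuclideanSpace.single 0 1 +
      (c * (u - w) + c * (u + 2 * w) + c * (v - w)) • EuclideanSpace.single 0 1 + (-(2 * (2 * u + v) * c)) • EuclideanSpace.single 1 1 := by
    ext k
    fin_cases k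
    · simp [ha0]; ring
    · simp [ha1]; ring
    · simp [ha2]
    · simp [ha3]
  -- the three pieces `J₁ = T_a (R·f₁†)`, `J₂ = T_{a-θ₁e₀} (R·f₁)`, `W₂ = T_b Y`, and the factorisation of the period
  obtain ⟨J₁, hJ₁⟩ : ∃ J : 𝓢((Fin 1 → E4), ℂ), J = translateMulti a (linActMulti R (osAdjoint f₁)) := ⟨_, rfl⟩
  obtain ⟨J₂, hJ₂⟩ : ∃ J : 𝓢((Fin 1 → E4), ℂ),
      J = translateMulti (a - (c * (v - w) + c * (u + 2 * w) + c * (u - w)) • EuclideanSpace.single 0 1) (linActMulti R f₁) := ⟨_, rfl⟩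
  obtain ⟨W₂, hW₂⟩ : ∃ W : 𝓢((Fin m → E4), ℂ), W = translateMulti ((-(2 * (2 * u + v) * c)) • EuclideanSpace.single 1 1) Y :=
    ⟨_, rfl⟩
  have hper : translateMulti a ((linActMulti R (osAdjoint f₁)).appendTensor ((linActMulti R f₁).appendTensor (translateMulti a Y))) =
      J₁.appendTensor (translateMulti ((c * (v - w) + c * (u + 2 * w) + c * (u - w)) • EuclideanSpace.single 0 1)
        (J₂.appendTensor (translateMulti ((c * (u - w) + c * (u + 2 * w) + c * (v - w)) • EuclideanSpace.single 0 1) W₂))) := by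
    rw [hJ₁, hJ₂, hW₂]
    exact tiltedPeriod_factor _ _ Y a _ _ _ hab
  rw [hper]
  -- `J₁` in true coordinates: product form, window, `L¹` data
  have hJ₁prod : ∀ x : Fin 1 → E4, J₁ x = conj (g ((2 * u + v) - c * (x 0 0 - x 0 1), c * (x 0 0 + x 0 1))) * conj (hh (x 0 2, x 0 3)) := by
    intro x
    rw [hJ₁, translateMulti_apply, linActMulti_apply, osAdjoint_apply, hf₁, map_mul]
    simp only [hrev, fun z => (hθ z).1, fun z => (hθ z).2.1, fun z => (hθ z).2.2.1, fun z => (hθ z).2.2.2, PiLp.sub_apply,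
      ha0, ha1, ha2, ha3, sub_zero, sub_neg_eq_add]
    congr 3
    rw [Prod.mk.injEq]
    exact ⟨by linear_combination (2 * (2 * u + v)) * hc2, by ring⟩
  have hg₁win : ∀ p : ℝ × ℝ, conj (g ((2 * u + v) - c * (p.1 - p.2), c * (p.1 + p.2))) ≠ 0 →
      c * (v - w) ≤ p.1 ∧ p.1 ≤ c * (v - w) + c * (u + 2 * w) := by
    intro p hp
    obtain ⟨h1, h2, h3⟩ := hg ((2 * u + v) - c * (p.1 - p.2), c * (p.1 + p.2)) fun h0 => hp (by rw [h0, map_zero])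
    dsimp only at h1 h2 h3
    rw [abs_le] at h3
    have hp1 : p.1 = c * (c * (p.1 - p.2) + c * (p.1 + p.2)) := by linear_combination (-2 * p.1) * hc2
    constructor
    · calc c * (v - w) ≤ c * (c * (p.1 - p.2) + c * (p.1 + p.2)) := mul_le_mul_of_nonneg_left (by linarith) hc0.le
        _ = p.1 := hp1.symm
    · calc p.1 = c * (c * (p.1 - p.2) + c * (p.1 + p.2)) := hp1
        _ ≤ c * (u + v + w) := mul_le_mul_of_nonneg_left (by linarith) hc0.le
        _ = c * (v - w) + c * (u + 2 * w) := by ring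
  obtain ⟨hgi1, hgM1⟩ := integrable_comp_planeIsometry
    ((rotation (Circle.exp (Real.pi / 4))).trans (Complex.conjLIE.trans (LinearIsometryEquiv.neg ℝ))) ⟨2 * u + v, 0⟩
    (fun p => ((2 * u + v) - c * (p.1 - p.2), c * (p.1 + p.2))) (fun p => planeIsometry_rotConjNeg hc (2 * u + v) p) hgi
  have hg₁i : Integrable (fun p : ℝ × ℝ => conj (g ((2 * u + v) - c * (p.1 - p.2), c * (p.1 + p.2)))) := integrable_conj_plane hgi1
  have hg₁M : (∫ p : ℝ × ℝ, ‖conj (g ((2 * u + v) - c * (p.1 - p.2), c * (p.1 + p.2)))‖) ≤ Mg := by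
    simp only [Complex.norm_conj]
    exact hgM1 ▸ hMg
  have hhh₁M : (∫ p : ℝ × ℝ, ‖conj (hh p)‖) ≤ Mh := by simpa only [Complex.norm_conj] using hMh
  have hhh₁M' : ∀ p : ℝ × ℝ, ‖conj (hh p)‖ ≤ Mh' := fun p => by rw [Complex.norm_conj]; exact hMh' p
  -- `J₂` in true coordinates: product form, window, `L¹` data
  have hJ₂prod : ∀ x : Fin 1 → E4, J₂ x = g (c * (x 0 0 - x 0 1) - (2 * u + v) / 2, c * (x 0 0 + x 0 1) + (2 * u + v) / 2) * hh (x 0 2, x 0 3) := by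
    intro x
    rw [hJ₂, translateMulti_apply, linActMulti_apply, hf₁]
    simp only [fun z => (hR' z).1, fun z => (hR' z).2.1, fun z => (hR' z).2.2.1, fun z => (hR' z).2.2.2, PiLp.sub_apply,
      PiLp.smul_apply, smul_eq_mul, hs0, hs1, hs2, hs3, ha0, ha1, ha2, ha3, mul_one, mul_zero, sub_zero, sub_neg_eq_add]
    congr 2
    rw [Prod.mk.injEq]
    exact ⟨by linear_combination (-(2 * u + v)) * hc2, by linear_combination (2 * u + v) * hc2⟩
  have hg₂win : ∀ p : ℝ × ℝ, g (c * (p.1 - p.2) - (2 * u + v) / 2, c * (p.1 + p.2) + (2 * u + v) / 2) ≠ 0 →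
      c * (u - w) ≤ p.1 ∧ p.1 ≤ c * (u - w) + c * (u + 2 * w) := by
    intro p hp
    obtain ⟨h1, h2, h3⟩ := hg _ hp
    dsimp only at h1 h2 h3
    rw [abs_le] at h3
    have hp1 : p.1 = c * (c * (p.1 - p.2) + c * (p.1 + p.2)) := by linear_combination (-2 * p.1) * hc2
    constructor
    · calc c * (u - w) ≤ c * (c * (p.1 - p.2) + c * (p.1 + p.2)) := mul_le_mul_of_nonneg_left (by linarith) hc0.le
        _ = p.1 := hp1.symm
    · calc p.1 = c * (c * (p.1 - p.2) + c * (p.1 + p.2)) := hp1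
        _ ≤ c * (2 * u + w) := mul_le_mul_of_nonneg_left (by linarith) hc0.le
        _ = c * (u - w) + c * (u + 2 * w) := by ring
  obtain ⟨hg₂i, hgM2⟩ := integrable_comp_planeIsometry (rotation (Circle.exp (Real.pi / 4))) ⟨-((2 * u + v) / 2), (2 * u + v) / 2⟩
    (fun p => (c * (p.1 - p.2) - (2 * u + v) / 2, c * (p.1 + p.2) + (2 * u + v) / 2)) (fun p => planeIsometry_rot hc (2 * u + v) p) hgi
  -- time-ordering of the tail `W₂`, of `W₁ = J₂ ⊗ T_{θ₂e₀} W₂` and of the period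
  have hW₂ord : IsTimeOrdered W₂ := by
    rw [hW₂]
    exact OSReconstructionNoE1.isTimeOrdered_translateMulti hY₀ hb0.ge
  have hW₁ord : IsTimeOrdered (J₂.appendTensor (translateMulti ((c * (u - w) + c * (u + 2 * w) + c * (v - w)) • EuclideanSpace.single 0 1) W₂)) :=
    isTimeOrdered_windowHead_appendTensor (tsupport_subset_window_Icc
      (g := fun p => g (c * (p.1 - p.2) - (2 * u + v) / 2, c * (p.1 + p.2) + (2 * u + v) / 2)) (hh := hh) hJ₂prod hg₂win)
      hcu0 (by linarith only [hcv0]) hW₂ord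
  have hord : IsTimeOrdered (J₁.appendTensor (translateMulti ((c * (v - w) + c * (u + 2 * w) + c * (u - w)) • EuclideanSpace.single 0 1)
      (J₂.appendTensor (translateMulti ((c * (u - w) + c * (u + 2 * w) + c * (v - w)) • EuclideanSpace.single 0 1) W₂)))) :=
    isTimeOrdered_windowHead_appendTensor (tsupport_subset_window_Icc
      (g := fun p => conj (g ((2 * u + v) - c * (p.1 - p.2), c * (p.1 + p.2)))) (hh := fun p => conj (hh p)) hJ₁prod hg₁win)
      hcv0 (by linarith only [hcu0]) hW₁ord
  refine ⟨hord, fun hY hQY => ?_⟩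
  -- the two general-window bounds
  have h1 := hGW (c * (v - w)) (c * (u + 2 * w)) (c * (u - w)) hcv0 hℓ0 hcu0 hcv1 hcu1 J₁
    (fun p => conj (g ((2 * u + v) - c * (p.1 - p.2), c * (p.1 + p.2)))) (fun p => conj (hh p)) Mg Mh Mh' hJ₁prod hg₁win hg₁i hg₁M
    (integrable_conj_plane hhi) hhh₁M hhh₁M' (1 + m) _ hW₁ord hQY
  have h2 := hGW (c * (u - w)) (c * (u + 2 * w)) (c * (v - w)) hcu0 hℓ0 hcv0 hcu1 hcv1 J₂
    (fun p => g (c * (p.1 - p.2) - (2 * u + v) / 2, c * (p.1 + p.2) + (2 * u + v) / 2)) hh Mg Mh Mh' hJ₂prod hg₂win hg₂i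
    (hgM2 ▸ hMg) hhi hMh hMh' m W₂ hW₂ord hW₁ord
  -- the tail is a unitary translate of `Ψ_Y`
  have h3 : ‖h.fieldVec m (fun _ => ()) W₂ hW₂ord‖ = ‖h.fieldVec m (fun _ => ()) Y hY‖ := by
    have hsp : spatialPart 0 ((-(2 * (2 * u + v) * c)) • EuclideanSpace.single 1 1 : E4) = (-(2 * (2 * u + v) * c)) • EuclideanSpace.single 1 1 :=
      spatialPart_of_apply_eq_zero 0 hb0
    rw [← LinearIsometryEquiv.norm_map (h.translate ((-(2 * (2 * u + v) * c)) • EuclideanSpace.single 1 1)) (h.fieldVec m (fun _ => ()) Y hY),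
      h.translate_fieldVec ((-(2 * (2 * u + v) * c)) • EuclideanSpace.single 1 1 : E4) m (fun _ => ()) Y hY]
    congr 1
    exact fieldVec_congr_testFunction h (by rw [hW₂, hsp]) _ _
  -- constants: `c(v-w) ≥ v/2`, `c(u-w) ≥ u/2`, so each window factor is `≤ 16 (u^{-μ} + v^{-μ})`
  have hK : 0 ≤ C' * Mg * (Mh + Mh') := by positivity
  have hv2 : v / 2 ≤ c * (v - w) := by linarith only [mul_le_mul_of_nonneg_right hc23 (sub_nonneg.2 hwv'.le), hwv]
  have hu2 : u / 2 ≤ c * (u - w) := by linarith only [mul_le_mul_of_nonneg_right hc23 (sub_nonneg.2 hwu'.le), hwu]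
  have e1 := rpow_neg_le_sixteen_mul hμ0 hμ4 hv hv2
  have e2 := rpow_neg_le_sixteen_mul hμ0 hμ4 hu hu2
  have hA1 : (c * (v - w)) ^ (-μ) + (c * (u - w)) ^ (-μ) ≤ 16 * (u ^ (-μ) + v ^ (-μ)) := by linarith only [e1, e2]
  have hA2 : (c * (u - w)) ^ (-μ) + (c * (v - w)) ^ (-μ) ≤ 16 * (u ^ (-μ) + v ^ (-μ)) := by linarith only [e1, e2]
  have hA1n : 0 ≤ (c * (v - w)) ^ (-μ) + (c * (u - w)) ^ (-μ) := add_nonneg (Real.rpow_nonneg hcv0.le _) (Real.rpow_nonneg hcu0.le _)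
  have hA2n : 0 ≤ (c * (u - w)) ^ (-μ) + (c * (v - w)) ^ (-μ) := add_nonneg (Real.rpow_nonneg hcu0.le _) (Real.rpow_nonneg hcv0.le _)
  refine h1.trans ((mul_le_mul_of_nonneg_left h2 (mul_nonneg hK hA1n)).trans ?_)
  rw [h3]
  calc C' * Mg * (Mh + Mh') * ((c * (v - w)) ^ (-μ) + (c * (u - w)) ^ (-μ)) *
        (C' * Mg * (Mh + Mh') * ((c * (u - w)) ^ (-μ) + (c * (v - w)) ^ (-μ)) * ‖h.fieldVec m (fun _ => ()) Y hY‖)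
      ≤ C' * Mg * (Mh + Mh') * (16 * (u ^ (-μ) + v ^ (-μ))) *
        (C' * Mg * (Mh + Mh') * (16 * (u ^ (-μ) + v ^ (-μ))) * ‖h.fieldVec m (fun _ => ()) Y hY‖) := by
        apply mul_le_mul
        · exact mul_le_mul_of_nonneg_left hA1 hK
        · exact mul_le_mul_of_nonneg_right (mul_le_mul_of_nonneg_left hA2 hK) (norm_nonneg _)
        · exact mul_nonneg (mul_nonneg hK hA2n) (norm_nonneg _)
        · exact mul_nonneg hK (by positivity)
    _ = (C' * Mg * (Mh + Mh') * (16 * (u ^ (-μ) + v ^ (-μ)))) ^ 2 * ‖h.fieldVec m (fun _ => ()) Y hY‖ := by ring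

end Summit.QuantumFields.YangMills.Theorems.CurvatureSandwichBound.Sketch

end
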